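import Summits.CriticalPhenomena.SAWScalingLimit.Theses.SAWLoopFugacityFlow
import Literature.Probability.RandomPlanarGeometry.RestrictionMeasuresInteriorHolds
import Literature.Probability.RandomPlanarGeometry.OneSidedRestrictionHolds
import Literature.Probability.RandomPlanarGeometry.RestrictionMeasuresProofs
import Literature.Probability.RandomPlanarGeometry.SAWExcursionAvoidance
import Literature.Analysis.Complex.Montel

/-!
# Sketch (crux-ideate, ideator 2, round 1) for crux `AvoidanceLimit` (stmt-CriticalPhenomena-10649)

First lemmas of the two idea cards `thin-fill-pins-exponent` and `excursion-gauge`, stated over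
existing declarations. `thin_pins_five_eighths` is PROVED from the tree (LSW03 Cor. 8.6 and
Thm. 7.3 discharges + uniqueness of `P_α`).
-/

noncomputable section

open MeasureTheory Filter Set Topology
open scoped ENNReal NNReal

namespace Summit.CriticalPhenomena.SAWScalingLimit.Cruxes.AvoidanceLimit.IdeatorTwo

open Literature.Probability.RandomPlanarGeometry Literature.Probability.LatticeModels

/-! ## Card `thin-fill-pins-exponent` -/

/-- **Hinge of card 1 (continuum, PROVED here).** A two-sided chordal restriction measure of
exponent `α > 0` almost every sample of which has EMPTY INTERIOR has `α = 5/8` (hence is the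
SLE_{8/3} range law): `α < 5/8` is excluded by [LSW] Cor. 8.6
(`not_exists_isRestrictionMeasure_of_lt_five_eighths_holds`), `α > 5/8` by Thm. 7.3 (SLE_κ plus
Brownian bubbles: a.e. sample has an interior point,
`exists_isRestrictionMeasure_ae_interior_nonempty_holds`) and uniqueness of `P_α`
(`IsRestrictionMeasure.ae_of_exists`). -/
theorem thin_pins_five_eighths {α : ℝ} {P : Measure RestrictionConfig} (hα : 0 < α)
    (hP : IsRestrictionMeasure α P) (hthin : ∀ᵐ K : RestrictionConfig ∂P, interior (K : Set ℂ) = ∅) :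
    α = 5 / 8 := by
  by_contra hne
  rcases lt_or_gt_of_ne hne with hlt | hgt
  · exact not_exists_isRestrictionMeasure_of_lt_five_eighths_holds hα hlt ⟨P, hP⟩
  · have hne' : ∀ᵐ K : RestrictionConfig ∂P, (interior (K : Set ℂ)).Nonempty :=
      hP.ae_of_exists (exists_isRestrictionMeasure_ae_interior_nonempty_holds α hgt)
    have hfalse : ∀ᵐ K ∂P, False := by
      filter_upwards [hthin, hne'] with K h1 h2
      rw [h1] at h2
      exact Set.not_nonempty_empty h2
    haveI := hP.isProbabilityMeasure
    have hzero : P = 0 := ae_eq_bot.1 (Filter.eventually_false_iff_eq_bot.1 hfalse)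
    exact IsProbabilityMeasure.ne_zero P hzero

/-- **Transfer target of card 1 (value-free restriction FORM).** The crux with an UNSPECIFIED
exponent: there is ONE real `α` such that for every Dobrushin domain, hull subdomain, endpoint
approximation and restriction data `(φ, A, Φ, d)` the critical SAW avoidance probability tends to
`d ^ α`. (Conformal covariance + restriction form, no value.) -/
def RestrictionFormLimit : Prop :=
  ∃ α : ℝ, ∀ (D D' : DobrushinDomain) (a b : ℝ → Site 2), SAW.IsEndpointApprox D a b →
    D'.carrier ⊆ D.carrier → D'.pt 0 = D.pt 0 → D'.pt 1 = D.pt 1 →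
    (∃ ε : ℝ, 0 < ε ∧ D'.carrier ∩ Metric.ball (D.pt 0) ε = D.carrier ∩ Metric.ball (D.pt 0) ε ∧
      D'.carrier ∩ Metric.ball (D.pt 1) ε = D.carrier ∩ Metric.ball (D.pt 1) ε) →
    ∀ (φ : ConformalEquiv UpperHalfPlane.upperHalfPlaneSet D.carrier), D.IsChordalUniformizing φ →
    ∀ (A : Set ℂ), A = closure (UpperHalfPlane.upperHalfPlaneSet \
      {z | z ∈ UpperHalfPlane.upperHalfPlaneSet ∧ φ z ∈ D'.carrier}) →
    ∀ (Φ : ConformalEquiv (UpperHalfPlane.upperHalfPlaneSet \ A) UpperHalfPlane.upperHalfPlaneSet)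
      (d : ℝ), IsRestrictionMap A Φ → HasRestrictionDeriv A Φ d →
      Tendsto (fun δ => ((SAW.law D.carrier δ (a δ) (b δ)).map (fun γ => γ.curve))
        (CurveClass.rangeSubset (closure D'.carrier))) (𝓝[>] 0) (𝓝 (ENNReal.ofReal (d ^ α)))

/-- **Lattice stub `NullArea` of card 1 (bulk one-point decay):** the critical SAW chord comes
`ε`-close to a fixed bulk point with probability `→ 0` as `ε → 0`, uniformly in the mesh
(`limsup` in `δ` first). Gives: every Fell-subsequential limit of the ranges is Lebesgue-null,
hence has empty interior. Predicted order `ε^{2/3}` (bulk two-leg exponent `2 - 4/3`). -/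
def NullArea : Prop :=
  ∀ (D : DobrushinDomain) (a b : ℝ → Site 2), SAW.IsEndpointApprox D a b →
    ∀ z ∈ D.carrier, Tendsto (fun ε : ℝ => Filter.limsup
      (fun δ => ((SAW.law D.carrier δ (a δ) (b δ)).map (fun γ => γ.curve))
        {c : CurveClass ℂ | (c.range ∩ Metric.ball z ε).Nonempty}) (𝓝[>] (0 : ℝ)))
      (𝓝[>] 0) (𝓝 0)

/-- **Lattice stub `NoLakes` of card 1 (no macroscopic near-self-return), shared with crux (S):**
the probability that the SAW chord returns within `ε` of a point of itself after an excursion of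
diameter `≥ r` tends to `0` as `ε → 0`, uniformly in the mesh. Gives: the FILL of every
Fell-subsequential limit equals the limit of the ranges plus no enclosed open set. -/
def NoLakes : Prop :=
  ∀ (D : DobrushinDomain) (a b : ℝ → Site 2), SAW.IsEndpointApprox D a b →
    ∀ r : ℝ, 0 < r → Tendsto (fun ε : ℝ => Filter.limsup
      (fun δ => (SAW.law D.carrier δ (a δ) (b δ))
        {γ | ∃ i j : Fin (γ.walk.length + 1), i ≤ j ∧
          dist (meshPoint δ (γ.walk.getVert i)) (meshPoint δ (γ.walk.getVert j)) ≤ ε ∧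
          ∃ k : Fin (γ.walk.length + 1), i ≤ k ∧ k ≤ j ∧
            r ≤ dist (meshPoint δ (γ.walk.getVert i)) (meshPoint δ (γ.walk.getVert k))})
        (𝓝[>] (0 : ℝ)))
      (𝓝[>] 0) (𝓝 0)

/-- **Lattice stub `NoBoundaryTouch` of card 1 (no boundary crawling away from the marked
points), the third part of crux (S):** the SAW chord comes `ε`-close to `∂D` outside the balls
`B(a, r)`, `B(b, r)` with probability `→ 0` as `ε → 0`, uniformly in the mesh. With value-free
covariance it suffices to prove it in ONE domain with a flat lattice side. -/
def NoBoundaryTouch : Prop :=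
  ∀ (D : DobrushinDomain) (a b : ℝ → Site 2), SAW.IsEndpointApprox D a b →
    ∀ r : ℝ, 0 < r → Tendsto (fun ε : ℝ => Filter.limsup
      (fun δ => ((SAW.law D.carrier δ (a δ) (b δ)).map (fun γ => γ.curve))
        {c : CurveClass ℂ | ∃ z ∈ c.range, Metric.infDist z (frontier D.carrier) ≤ ε ∧
          r ≤ dist z (D.pt 0) ∧ r ≤ dist z (D.pt 1)}) (𝓝[>] (0 : ℝ)))
      (𝓝[>] 0) (𝓝 0)

/-! ## Card `excursion-gauge` -/

/-- The discrete excursion gauge: `h_G(p → q) = G(p,q)/G(q,q)` is the probability that the simple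
random walk from `p`, run on the subgraph `G` of `ℤ²` and killed at its first non-`G` step, hits
`q`; the GAUGE of the pair `(Ω'_δ ⊆ Ω_δ)` at `(a_δ, b_δ)` is the ratio
`h_{Ω'_δ}(a_δ → b_δ) / h_{Ω_δ}(a_δ → b_δ)` = the probability that the random-walk excursion of
`Ω_δ` from `a_δ` to `b_δ` stays in `Ω'_δ` (exact `h`-transform identity). -/
def excursionGauge (Ω Ω' : Set ℂ) (δ : ℝ) (p q : Site 2) : ℝ :=
  (SRWExcursion.killedGreen (discreteDomainGraph Ω' δ) p q /
      SRWExcursion.killedGreen (discreteDomainGraph Ω' δ) q q) /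
    (SRWExcursion.killedGreen (discreteDomainGraph Ω δ) p q /
      SRWExcursion.killedGreen (discreteDomainGraph Ω δ) q q)

/-- **First lemma of card 2 (provable now, discrete potential theory): the random-walk excursion
obeys the `b = 1` avoidance law.** For `D' ⊆ D` a hull subdomain agreeing with `D` near `a, b`
and an endpoint approximation good for both, the excursion gauge converges to the restriction
derivative `d = Φ'_A(0)` of the pulled-back hull ([LSW] Prop. 4.1 for the Brownian excursion,
`P[B ∩ A = ∅] = Φ'_A(0)`, plus convergence of discrete excursion-kernel RATIOS,
Kozdron–Lawler 2005). This strips `φ, A, Φ, d` from the crux. -/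
def ExcursionAvoidanceLimit : Prop :=
  ∀ (D D' : DobrushinDomain) (a b : ℝ → Site 2), SAW.IsEndpointApprox D a b →
    SAW.IsEndpointApprox D' a b →
    D'.carrier ⊆ D.carrier → D'.pt 0 = D.pt 0 → D'.pt 1 = D.pt 1 →
    (∃ ε : ℝ, 0 < ε ∧ D'.carrier ∩ Metric.ball (D.pt 0) ε = D.carrier ∩ Metric.ball (D.pt 0) ε ∧
      D'.carrier ∩ Metric.ball (D.pt 1) ε = D.carrier ∩ Metric.ball (D.pt 1) ε) →
    ∀ (φ : ConformalEquiv UpperHalfPlane.upperHalfPlaneSet D.carrier), D.IsChordalUniformizing φ →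
    ∀ (A : Set ℂ), A = closure (UpperHalfPlane.upperHalfPlaneSet \
      {z | z ∈ UpperHalfPlane.upperHalfPlaneSet ∧ φ z ∈ D'.carrier}) →
    ∀ (Φ : ConformalEquiv (UpperHalfPlane.upperHalfPlaneSet \ A) UpperHalfPlane.upperHalfPlaneSet)
      (d : ℝ), IsRestrictionMap A Φ → HasRestrictionDeriv A Φ d →
      Tendsto (fun δ => excursionGauge D.carrier D'.carrier δ (a δ) (b δ)) (𝓝[>] 0) (𝓝 d)

/-- **Transfer target of card 2 (the GAUGED crux, no conformal map in sight):** the critical SAW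
avoidance probability of `cl D'` is asymptotic to the `5/8`-th power of the excursion gauge of the
same pair of lattice domains at the same endpoints. With `ExcursionAvoidanceLimit` (and
`0 < d ≤ 1`) this is equivalent to the crux on approximations good for `D'`. -/
def GaugedAvoidanceLimit : Prop :=
  ∀ (D D' : DobrushinDomain) (a b : ℝ → Site 2), SAW.IsEndpointApprox D a b →
    SAW.IsEndpointApprox D' a b →
    D'.carrier ⊆ D.carrier → D'.pt 0 = D.pt 0 → D'.pt 1 = D.pt 1 →
    (∃ ε : ℝ, 0 < ε ∧ D'.carrier ∩ Metric.ball (D.pt 0) ε = D.carrier ∩ Metric.ball (D.pt 0) ε ∧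
      D'.carrier ∩ Metric.ball (D.pt 1) ε = D.carrier ∩ Metric.ball (D.pt 1) ε) →
    Tendsto (fun δ => (((SAW.law D.carrier δ (a δ) (b δ)).map (fun γ => γ.curve))
        (CurveClass.rangeSubset (closure D'.carrier))).toReal /
      (excursionGauge D.carrier D'.carrier δ (a δ) (b δ)) ^ ((5 : ℝ) / 8)) (𝓝[>] 0) (𝓝 1)

/-- **Relative-intensity stub of card 2 (mesoscopic relative locality):** for boundary bumps the
SAW's visit probability is asymptotically `5/8` of the excursion's, uniformly in the far geometry.
Stated in the integrated form the double exact cocycle needs: the log-ratio of the two avoidance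
probabilities tends to `5/8` for every hull pair with `d < 1`. -/
def RelativeExponent : Prop :=
  ∀ (D D' : DobrushinDomain) (a b : ℝ → Site 2), SAW.IsEndpointApprox D a b →
    SAW.IsEndpointApprox D' a b →
    D'.carrier ⊆ D.carrier → D'.carrier ≠ D.carrier → D'.pt 0 = D.pt 0 → D'.pt 1 = D.pt 1 →
    (∃ ε : ℝ, 0 < ε ∧ D'.carrier ∩ Metric.ball (D.pt 0) ε = D.carrier ∩ Metric.ball (D.pt 0) ε ∧
      D'.carrier ∩ Metric.ball (D.pt 1) ε = D.carrier ∩ Metric.ball (D.pt 1) ε) →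
    Tendsto (fun δ => Real.log (((SAW.law D.carrier δ (a δ) (b δ)).map (fun γ => γ.curve))
        (CurveClass.rangeSubset (closure D'.carrier))).toReal /
      Real.log (excursionGauge D.carrier D'.carrier δ (a δ) (b δ))) (𝓝[>] 0) (𝓝 ((5 : ℝ) / 8))


/-! ## Card `continue-the-defect` -/

/-- **Hinge of card 2 (complex analysis, provable now from the tree's Montel theorem
`Complex.exists_strictMono_tendstoLocallyUniformlyOn` + Mathlib's identity theorem): Vitali for the
zero limit.** A locally bounded sequence of holomorphic functions on a connected open `U` that tends
to `0` pointwise on a set `W ⊆ U` accumulating at a point of `U` tends to `0` at EVERY point of `U`.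
Applied to the covariance defect `Δ_δ(n) = R_δ(n; D, D') − R_δ(n; D̃, D̃')` of two hull pairs with
the same pulled-back hull: `Δ_δ → 0` on the Ising window `W = (1 − ε, 1]` plus a `δ`-uniform bound on
a complex neighbourhood `U ⊇ [0, 1]` give `Δ_δ(0) → 0` = value-free covariance of SAW avoidance. -/
def VitaliZero : Prop :=
  ∀ (U W : Set ℂ) (F : ℕ → ℂ → ℂ) (z₀ : ℂ), IsOpen U → IsPreconnected U → W ⊆ U → z₀ ∈ U →
    (∃ᶠ z in 𝓝[≠] z₀, z ∈ W) →
    (∀ k, DifferentiableOn ℂ (F k) U) →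
    (∀ a ∈ U, ∃ M : ℝ, ∃ r > 0, ∀ k, ∀ z ∈ Metric.ball a r ∩ U, ‖F k z‖ ≤ M) →
    (∀ w ∈ W, Tendsto (fun k => F k w) atTop (𝓝 0)) →
    ∀ z ∈ U, Tendsto (fun k => F k z) atTop (𝓝 0)


/-- **`VitaliZero` PROVED** from the tree's Montel theorem and Mathlib's identity theorem. -/
theorem vitaliZero_holds : VitaliZero := by
  intro U W F z₀ hU hUc hWU hz₀ hacc hF hb hW z hz
  by_contra hnot
  -- a subsequence along which `F _ z` stays `ε`-away from `0`
  obtain ⟨ε, hε, hfreq⟩ : ∃ ε > 0, ∃ᶠ k in atTop, ε ≤ ‖F k z‖ := by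
    by_contra h
    push Not at h
    apply hnot
    rw [tendsto_zero_iff_norm_tendsto_zero]
    refine Metric.tendsto_atTop.2 fun ε hε => ?_
    obtain ⟨N, hN⟩ := Filter.eventually_atTop.1 (h ε hε)
    exact ⟨N, fun n hn => by simpa [Real.dist_eq, abs_of_nonneg (norm_nonneg _)] using hN n hn⟩
  obtain ⟨φ, hφ, hφε⟩ := Filter.extraction_of_frequently_atTop hfreq
  -- Montel on the subsequence
  obtain ⟨f, ψ, hψ, hfd, hlim, -⟩ :=
    Complex.exists_strictMono_tendstoLocallyUniformlyOn_deriv hU (F := fun k => F (φ k))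
      (fun k => hF (φ k)) (fun a ha => by
        obtain ⟨M, r, hr, hM⟩ := hb a ha
        exact ⟨M, r, hr, fun k w hw => hM (φ k) w hw⟩)
  -- the limit vanishes on `W`
  have hfW : ∀ w ∈ W, f w = 0 := by
    intro w hw
    have h1 : Tendsto (fun k => F (φ (ψ k)) w) atTop (𝓝 (f w)) := hlim.tendsto_at (hWU hw)
    have h2 : Tendsto (fun k => F (φ (ψ k)) w) atTop (𝓝 0) :=
      (hW w hw).comp ((hφ.comp hψ).tendsto_atTop)
    exact tendsto_nhds_unique h1 h2
  -- identity theorem: `f ≡ 0` on `U`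
  have hf0 : Set.EqOn f 0 U :=
    (hfd.analyticOnNhd hU).eqOn_zero_of_preconnected_of_frequently_eq_zero hUc hz₀
      (hacc.mono fun w hw => hfW w hw)
  -- contradiction at `z`
  have h3 : Tendsto (fun k => F (φ (ψ k)) z) atTop (𝓝 0) := by
    have := hlim.tendsto_at hz
    rwa [hf0 hz] at this
  have h4 : ∀ᶠ k in atTop, ‖F (φ (ψ k)) z‖ < ε := by
    have := (tendsto_zero_iff_norm_tendsto_zero.1 h3)
    exact (this.eventually (gt_mem_nhds hε))
  obtain ⟨k, hk⟩ := h4.exists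
  exact absurd (hφε (ψ k)) (not_le.2 hk)

/-- **The exponent function of the dilute branch in closed form** (numbers for the cards):
`b(n) = (6 − κ)/(2κ)` with `n = −2 cos(4π/κ)`, `κ ∈ [2, 4]`, equals `1 − (3/(4π)) arccos(−n/2)`;
`b(0) = 5/8`, `b(1) = 1/2`, `b'(n) = −3/(4π √(4 − n²))`, so `b'(0) = −3/(8π)`, `b'(1) = −√3/(4π)`. -/
def diluteBoundaryExponent (n : ℝ) : ℝ := 1 - 3 / (4 * Real.pi) * Real.arccos (-n / 2)

example : diluteBoundaryExponent 0 = 5 / 8 := by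
  simp only [diluteBoundaryExponent, neg_zero, zero_div, Real.arccos_zero]
  field_simp
  ring

example : diluteBoundaryExponent 1 = 1 / 2 := by
  have h0 : Real.arccos (1 / 2) = Real.pi / 3 := by
    rw [← Real.cos_pi_div_three, Real.arccos_cos (by positivity) (by linarith [Real.pi_pos])]
  have h : Real.arccos (-1 / 2) = 2 * Real.pi / 3 := by
    rw [show (-1 / 2 : ℝ) = -(1 / 2) by norm_num, Real.arccos_neg, h0]; ring
  simp only [diluteBoundaryExponent, h]
  field_simp
  ring

/-- Sanity: the crux decl of the route is in scope (the cards conclude it by name). -/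
example : Prop := Summit.CriticalPhenomena.SAWScalingLimit.Theses.SAWLoopFugacityFlow.AvoidanceLimit

end Summit.CriticalPhenomena.SAWScalingLimit.Cruxes.AvoidanceLimit.IdeatorTwo

end
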